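import Literature.NumberTheory.Sieve.GreenTao2008SharpGYShiftLocal
import Literature.NumberTheory.Sieve.GreenTao2008SharpGYTwoLevel
import Literature.NumberTheory.Sieve.SmoothMajorantAssembly
import Literature.NumberTheory.Sieve.GreenTao2008Majorant
import HarnessLib

/-!
# Green–Tao (2008), Proposition 9.6 (Goldston–Yıldırım correlation estimate): the discharge

This file assembles the elementary proof of the named fact
`Literature.NumberTheory.Sieve.GreenTao2008.GoldstonYildirimCorrelations` (B. Green, T. Tao, Ann. of
Math. 167 (2008), Proposition 9.6) for the shift system `θ_i(x) = W(x + h_i) + 1`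
(`L = (1 : Fin m → Fin 1 → ℤ)`, `b = h` in the tree's `CFZ`/`SharpGY` language) from:
the S-expansion of the sharp tuple sum around the product model (`GreenTao2008SharpGYTuples`:
`sharpTupleSum_eq_sum_sTerm`, `sTerm_empty`, `sTerm_eq_sum_prod_diagSum`), the local factors of the
shift system (`GreenTao2008SharpGYShiftLocal`, Lemma 10.5), the two-level evaluation of the one-form
sum (`GreenTao2008SharpGYTwoLevel.exists_diagSum_bound`) and the CFZ front end
(`SmoothMajorantAssembly`). The printed proof (§10 + App. A of the source) is a `2m`-fold contour
integration; here only the term `S = ∅` (the `m`-th power of `S₁(W; R, R)`) needs an asymptotic, all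
other terms being bounded crudely and absorbed into `∏_{p ∣ Δ}(1 + O_m(p^{-1/2}))` and `o(1)`.

## References
* B. Green, T. Tao, Ann. of Math. (2) 167 (2008), 481–547: Prop. 9.6, §10 (Lemma 10.5, (10.11),
  Lemmas 10.6, 10.7), App. A. [cite: GreenTaoAnnals2008]
-/

noncomputable section

open Finset Filter Real
open scoped BigOperators ArithmeticFunction.Moebius Topology

namespace Literature.NumberTheory.Sieve.GreenTao2008

namespace GYCorr

open SharpGY CFZ

variable {m : ℕ}

/-! ### The key elementary inequality -/

/-- **The key elementary inequality** behind "`∏_{p ∣ Δ}(1 + O(p^{-1/2}))` absorbs constants":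
for `K ≥ 1` and `b_i ≥ 0`, `1 + K (∏_i (1 + b_i) - 1) ≤ ∏_i (1 + K b_i)`. [folklore] -/
theorem one_add_mul_prod_sub_one_le {α : Type*} [DecidableEq α] (s : Finset α) {K : ℝ} (hK : 1 ≤ K)
    {b : α → ℝ} (hb : ∀ i ∈ s, 0 ≤ b i) :
    1 + K * (∏ i ∈ s, (1 + b i) - 1) ≤ ∏ i ∈ s, (1 + K * b i) := by
  induction s using Finset.induction_on with
  | empty => simp
  | insert j s hj ih =>
    have hbj : 0 ≤ b j := hb j (mem_insert_self _ _)
    have hbs : ∀ i ∈ s, 0 ≤ b i := fun i hi => hb i (mem_insert_of_mem hi)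
    have ih' := ih hbs
    rw [Finset.prod_insert hj, Finset.prod_insert hj]
    have hA : 1 ≤ ∏ i ∈ s, (1 + b i) := by
      have := Finset.prod_le_prod (s := s) (f := fun _ => (1 : ℝ)) (g := fun i => 1 + b i)
        (fun _ _ => zero_le_one) (fun i hi => by linarith [hbs i hi])
      simpa using this
    set A := ∏ i ∈ s, (1 + b i) with hAdef
    set Q := ∏ i ∈ s, (1 + K * b i) with hQdef
    have hKbj : 0 ≤ 1 + K * b j := by nlinarith
    have h1 := mul_le_mul_of_nonneg_left ih' hKbj
    have hx : 0 ≤ K * (b j * ((K - 1) * (A - 1))) :=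
      mul_nonneg (by linarith) (mul_nonneg hbj (mul_nonneg (by linarith) (by linarith)))
    nlinarith [h1, hx]

/-! ### The terms `S ≠ ∅` of the expansion for the shift system -/

section Estimate

variable {P : Finset ℕ} (hP : ∀ p ∈ P, p.Prime) {W : ℕ} (hW : W ≠ 0) {R : ℝ} (h : Fin m → ℤ)
include hP hW

/-- **The term indexed by `S` off `W`, for the shift system**: given per-prime bounds
`∑_Y |Δ_p(Y)| ≤ γ_p` (`p ∈ S`), `|Σ_S| ≤ (∏_{p∈S} 4^m γ_p) (B² (W/φ(W))² G_W(R))^m`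
(the template of `SharpGY.abs_sTerm_le` with the generic local bound replaced by `γ`).
[cite: GreenTaoAnnals2008, Section 10 eq. 10.8 and Lemma 10.7] -/
theorem abs_sTerm_one_le {S : Finset ℕ} (hS : S ⊆ P) (hSW : ∀ p ∈ S, ¬ p ∣ W)
    (hPW : ∀ p : ℕ, p.Prime → p ∣ W → p ∈ P) (hR : 1 ≤ R)
    (hPR : ∀ p : ℕ, p.Prime → (p : ℝ) ≤ R → p ∈ P) {B : ℝ} (hB : ∀ y, |moebLog y| ≤ B)
    {γ : ℕ → ℝ} (hγ : ∀ p ∈ S, ∑ Y : Finset (Fin m ⊕ Fin m), |locD p W (1 : Fin m → Fin 1 → ℤ) h Y| ≤ γ p) :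
    |sTerm P S W (1 : Fin m → Fin 1 → ℤ) h R| ≤ (∏ p ∈ S, 4 ^ m * γ p) *
      (B ^ 2 * ((W : ℝ) / (W.totient : ℝ)) ^ 2 * invTotSum W R) ^ m := by
  classical
  have hSp : ∀ p ∈ S, p.Prime := fun p hp => hP p (hS hp)
  set s : ℕ := ∏ p ∈ S, p with hs
  have hs0 : s ≠ 0 := prod_ne_zero_iff.2 fun p hp => (hSp p hp).ne_zero
  have hsW : s.Coprime W := Nat.Coprime.prod_left fun p hp =>
    (Nat.Prime.coprime_iff_not_dvd (hSp p hp)).2 (hSW p hp)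
  have hsW0 : s * W ≠ 0 := mul_ne_zero hs0 hW
  set K₀ : ℝ := B ^ 2 * ((W : ℝ) / (W.totient : ℝ)) ^ 2 * invTotSum W R with hK₀
  have hK0 : 0 ≤ K₀ := by have := invTotSum_nonneg W R; positivity
  set L₁ : Fin m → Fin 1 → ℤ := 1 with hL₁
  rw [sTerm_eq_sum_prod_diagSum hP hS hSW L₁ h hPW hR hPR]
  -- uniform bound for the product of diagonal sums
  have hD : ∀ u ∈ Fintype.piFinset (fun _ : Fin m ⊕ Fin m => squarefreeOf S),
      |∏ j : Fin m, diagSum (s * W) (R / u (Sum.inl j)) (R / u (Sum.inr j))| ≤ (∏ _p ∈ S, (4 : ℝ) ^ m) * K₀ ^ m := by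
    intro u hu
    rw [Fintype.mem_piFinset] at hu
    have hu1 : ∀ v, (1 : ℝ) ≤ u v := fun v => by exact_mod_cast one_le_of_mem_squarefreeOf hSp (hu v)
    rw [abs_prod]
    have hq : ((s * W : ℕ) : ℝ) / ((s * W).totient : ℝ) = (s : ℝ) / (s.totient : ℝ) * ((W : ℝ) / (W.totient : ℝ)) :=
      div_totient_mul hsW
    have hterm : ∀ j : Fin m, |diagSum (s * W) (R / u (Sum.inl j)) (R / u (Sum.inr j))| ≤
        ((s : ℝ) / (s.totient : ℝ)) ^ 2 * K₀ := by
      intro j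
      have h := abs_diagSum_le hB hsW0 (dvd_mul_left W s) (R / u (Sum.inl j)) (R / u (Sum.inr j))
      rw [hq] at h
      refine h.trans ?_
      have hmono : invTotSum W (R / u (Sum.inl j)) ≤ invTotSum W R :=
        invTotSum_mono W (div_le_self (by linarith) (hu1 _))
      have hB0 : 0 ≤ B ^ 2 * ((s : ℝ) / (s.totient : ℝ) * ((W : ℝ) / (W.totient : ℝ))) ^ 2 := by positivity
      calc B ^ 2 * ((s : ℝ) / (s.totient : ℝ) * ((W : ℝ) / (W.totient : ℝ))) ^ 2 * invTotSum W (R / u (Sum.inl j))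
          ≤ B ^ 2 * ((s : ℝ) / (s.totient : ℝ) * ((W : ℝ) / (W.totient : ℝ))) ^ 2 * invTotSum W R :=
            mul_le_mul_of_nonneg_left hmono hB0
        _ = ((s : ℝ) / (s.totient : ℝ)) ^ 2 * K₀ := by rw [hK₀]; ring
    calc ∏ j : Fin m, |diagSum (s * W) (R / u (Sum.inl j)) (R / u (Sum.inr j))|
        ≤ ∏ _j : Fin m, ((s : ℝ) / (s.totient : ℝ)) ^ 2 * K₀ := prod_le_prod (fun j _ => abs_nonneg _) fun j _ => hterm j
      _ = (((s : ℝ) / (s.totient : ℝ)) ^ 2) ^ m * K₀ ^ m := by rw [prod_const, card_univ, Fintype.card_fin, mul_pow]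
      _ ≤ (∏ _p ∈ S, (4 : ℝ)) ^ m * K₀ ^ m := by
          have h1 : (((s : ℝ) / (s.totient : ℝ)) ^ 2) ≤ ∏ _p ∈ S, (4 : ℝ) := div_totient_prod_sq_le hSp
          exact mul_le_mul_of_nonneg_right (pow_le_pow_left₀ (by positivity) h1 m) (pow_nonneg hK0 m)
      _ = (∏ _p ∈ S, (4 : ℝ) ^ m) * K₀ ^ m := by rw [prod_pow]
  -- the sum of `|Δ_S(u)|` is an Euler product
  have hΔ : ∑ u ∈ Fintype.piFinset (fun _ : Fin m ⊕ Fin m => squarefreeOf S), |∏ p ∈ S, locD p W L₁ h (pattern u p)| ≤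
      ∏ p ∈ S, γ p := by
    have heq : ∑ u ∈ Fintype.piFinset (fun _ : Fin m ⊕ Fin m => squarefreeOf S), |∏ p ∈ S, locD p W L₁ h (pattern u p)| =
        ∏ p ∈ S, ∑ Y : Finset (Fin m ⊕ Fin m), |locD p W L₁ h Y| := by
      rw [← prod_coe_sort S, ← sum_squarefreeTuples_eq_prod hSp (fun p Y => |locD (p : ℕ) W L₁ h Y|)]
      refine sum_congr rfl fun u _ => ?_
      rw [abs_prod, ← prod_coe_sort S]
    rw [heq]
    exact prod_le_prod (fun p _ => sum_nonneg fun Y _ => abs_nonneg _) fun p hp => hγ p hp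
  have hγ0 : ∀ p ∈ S, 0 ≤ γ p := fun p hp => le_trans (sum_nonneg fun Y _ => abs_nonneg _) (hγ p hp)
  -- combine
  calc |∑ u ∈ Fintype.piFinset (fun _ : Fin m ⊕ Fin m => squarefreeOf S),
          (∏ p ∈ S, locD p W L₁ h (pattern u p)) * ∏ j : Fin m, diagSum (s * W) (R / u (Sum.inl j)) (R / u (Sum.inr j))|
      ≤ ∑ u ∈ Fintype.piFinset (fun _ : Fin m ⊕ Fin m => squarefreeOf S),
          |∏ p ∈ S, locD p W L₁ h (pattern u p)| * ((∏ _p ∈ S, (4 : ℝ) ^ m) * K₀ ^ m) := by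
        refine (abs_sum_le_sum_abs _ _).trans (sum_le_sum fun u hu => ?_)
        rw [abs_mul]
        exact mul_le_mul_of_nonneg_left (hD u hu) (abs_nonneg _)
    _ ≤ (∏ p ∈ S, γ p) * ((∏ _p ∈ S, (4 : ℝ) ^ m) * K₀ ^ m) := by
        rw [← sum_mul]
        exact mul_le_mul_of_nonneg_right hΔ (by positivity)
    _ = (∏ p ∈ S, 4 ^ m * γ p) * K₀ ^ m := by
        rw [← mul_assoc, ← prod_mul_distrib]
        congr 1
        exact prod_congr rfl fun p _ => by ring

/-- **The sharp tuple sum of the shift system is `S₁(W;R,R)^m` up to coupled primes**: with per-prime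
bounds `∑_Y |Δ_p(Y)| ≤ γ_p` for the primes `p ∤ W` of `P`,
`|S(P) - S₁(W;R,R)^m| ≤ (∏_{p ∈ P, p ∤ W} (1 + 4^m γ_p) - 1) (B² (W/φ(W))² G_W(R))^m`.
[cite: GreenTaoAnnals2008, Section 10, Lemmas 10.6–10.7] -/
theorem abs_sharpTupleSum_one_sub_pow_le (hPW : ∀ p : ℕ, p.Prime → p ∣ W → p ∈ P) (hR : 1 ≤ R)
    (hPR : ∀ p : ℕ, p.Prime → (p : ℝ) ≤ R → p ∈ P) {B : ℝ} (hB : ∀ y, |moebLog y| ≤ B)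
    {γ : ℕ → ℝ} (hγ0 : ∀ p ∈ P, 0 ≤ γ p)
    (hγ : ∀ p ∈ P, ¬ p ∣ W → ∑ Y : Finset (Fin m ⊕ Fin m), |locD p W (1 : Fin m → Fin 1 → ℤ) h Y| ≤ γ p) :
    |sharpTupleSum P W (1 : Fin m → Fin 1 → ℤ) h R - diagSum W R R ^ m| ≤
      (∏ p ∈ P, (1 + (if p ∣ W then 0 else 4 ^ m * γ p)) - 1) *
        (B ^ 2 * ((W : ℝ) / (W.totient : ℝ)) ^ 2 * invTotSum W R) ^ m := by
  classical
  set L₁ : Fin m → Fin 1 → ℤ := 1 with hL₁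
  set K₀ : ℝ := B ^ 2 * ((W : ℝ) / (W.totient : ℝ)) ^ 2 * invTotSum W R with hK₀
  have hK0 : 0 ≤ K₀ := by have := invTotSum_nonneg W R; positivity
  set c : ℕ → ℝ := fun p => if p ∣ W then 0 else 4 ^ m * γ p with hc
  have hc0 : ∀ p ∈ P, 0 ≤ c p := fun p hp => by
    simp only [hc]; split_ifs; · exact le_rfl
    · exact mul_nonneg (by positivity) (hγ0 p hp)
  have hterm : ∀ S ∈ P.powerset, S ≠ ∅ → |sTerm P S W L₁ h R| ≤ (∏ p ∈ S, c p) * K₀ ^ m := by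
    intro S hS hSne
    have hS' : S ⊆ P := mem_powerset.1 hS
    by_cases hgood : ∀ p ∈ S, ¬ p ∣ W
    · have hprod : ∏ p ∈ S, c p = ∏ p ∈ S, 4 ^ m * γ p :=
        prod_congr rfl fun p hp => by simp only [hc]; rw [if_neg (hgood p hp)]
      rw [hprod]
      exact abs_sTerm_one_le hP hW h hS' hgood hPW hR hPR hB fun p hp => hγ p (hS' hp) (hgood p hp)
    · push Not at hgood
      obtain ⟨p, hpS, hpW⟩ := hgood
      rw [sTerm_eq_zero_of_dvd hP hS' hpS hpW L₁ h, abs_zero]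
      exact mul_nonneg (prod_nonneg fun q hq => hc0 q (hS' hq)) (pow_nonneg hK0 m)
  rw [sharpTupleSum_eq_sum_sTerm hP W L₁ h R, ← Finset.add_sum_erase _ _ (empty_mem_powerset P),
    sTerm_empty hP L₁ h hPW hR hPR, add_sub_cancel_left]
  have hsum : |∑ S ∈ (P.powerset).erase ∅, sTerm P S W L₁ h R| ≤ (∑ S ∈ (P.powerset).erase ∅, ∏ p ∈ S, c p) * K₀ ^ m := by
    refine (abs_sum_le_sum_abs _ _).trans ?_
    rw [sum_mul]
    exact sum_le_sum fun S hS => hterm S (mem_of_mem_erase hS) (ne_of_mem_erase hS)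
  refine hsum.trans (mul_le_mul_of_nonneg_right (le_of_eq ?_) (pow_nonneg hK0 m))
  rw [prod_one_add, ← Finset.add_sum_erase _ _ (empty_mem_powerset P), prod_empty]
  ring

end Estimate

/-! ### The front end: from the box average of `∏ Λ_R²` to the sharp tuple sum -/

/-- `Λ_R(n) = (log R) · ∑_{d ≤ R, d ∣ n} c(d)` with the normalised coefficients
`c(d) = μ(d) λ_R(d)/log R`. [cite: GreenTaoAnnals2008, Definition 9.2] -/
theorem truncatedDivisorSum_eq_mul_divSum {R : ℝ} (hR : 1 < R) (n : ℤ) :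
    truncatedDivisorSum R n =
      Real.log R * CFZ.divSum (fun d => (μ d : ℝ) * lamR R d / Real.log R) R n := by
  have hlog : Real.log R ≠ 0 := (Real.log_pos hR).ne'
  unfold truncatedDivisorSum CFZ.divSum
  rw [Finset.mul_sum]
  refine Finset.sum_congr rfl fun d hd => ?_
  have hd' := (Finset.mem_filter.1 hd).1
  rw [Finset.mem_Icc] at hd'
  have hdR : (d : ℝ) ≤ R := le_trans (by exact_mod_cast hd'.2) (Nat.floor_le (by linarith))
  rw [lamR_eq_log hd'.1 hdR]
  field_simp

/-- The normalised coefficients are bounded by `1` and vanish off the square-free numbers.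
[cite: GreenTaoAnnals2008, Definition 9.2] -/
theorem abs_coef_le_one {R : ℝ} (hR : 1 < R) (d : ℕ) : |(μ d : ℝ) * lamR R d / Real.log R| ≤ 1 := by
  have hlog : 0 < Real.log R := Real.log_pos hR
  have hμ : |(μ d : ℝ)| ≤ 1 := by exact_mod_cast ArithmeticFunction.abs_moebius_le_one
  have hl0 : 0 ≤ lamR R d := lamR_nonneg R d
  have hl1 : lamR R d ≤ Real.log R := by
    rcases Nat.eq_zero_or_pos d with rfl | hd
    · unfold lamR; simp [hlog.le]
    · exact lamR_le_log hR.le hd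
  rw [abs_div, abs_mul, abs_of_pos hlog, abs_of_nonneg hl0, div_le_one hlog]
  calc |(μ d : ℝ)| * lamR R d ≤ 1 * Real.log R := mul_le_mul hμ hl1 hl0 zero_le_one
    _ = Real.log R := one_mul _

/-- A one-dimensional box is an interval. [folklore] -/
theorem expect_Ico_eq_expect_piFinset (a : ℤ) (ℓ : ℕ) (F : ℤ → ℝ) :
    𝔼 x ∈ Ico a (a + ℓ), F x = 𝔼 y ∈ Fintype.piFinset (fun _ : Fin 1 => Ico a (a + ℓ)), F (y 0) := by
  refine Finset.expect_nbij' (fun x => fun _ => x) (fun y => y 0) ?_ ?_ ?_ ?_ ?_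
  · intro x hx; exact Fintype.mem_piFinset.2 fun _ => hx
  · intro y hy; exact Fintype.mem_piFinset.1 hy 0
  · intro x _; rfl
  · intro y _; funext k; rw [Fin.fin_one_eq_zero k]
  · intro x _; rfl

/-- The integrand of Prop. 9.6 in the CFZ language (`θ_i = wForm W 1 h_i`, `Λ_R = (log R)·divSum c`).
[cite: GreenTaoAnnals2008, Section 10 eq. 10.1] -/
theorem prod_truncatedDivisorSum_sq_eq {R : ℝ} (hR : 1 < R) (W : ℕ) (h : Fin m → ℤ) (y : Fin 1 → ℤ) :
    ∏ i, truncatedDivisorSum R (W * (y 0 + h i) + 1) ^ 2 =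
      ∏ i, (Real.log R * CFZ.divSum (fun d => (μ d : ℝ) * lamR R d / Real.log R) R
        (CFZ.wForm W ((1 : Fin m → Fin 1 → ℤ) i) (h i) y)) ^ 2 := by
  refine Finset.prod_congr rfl fun i _ => ?_
  rw [wForm_one, truncatedDivisorSum_eq_mul_divSum hR, Int.cast_id]

/-- **The front end** (Green–Tao (10.1)–(10.3) for the shift system; CFZ (28)–(29)): for an
interval `B = [a, a + ℓ)` with `ℓ ≥ R^{2m}` and a finite set of primes `P` containing every prime
`≤ R`,
`|E_{x ∈ B} ∏_i Λ_R(W(x+h_i)+1)² - S(P)| ≤ (log R)^{2m} R^{4m}/ℓ`,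
`S(P) = sharpTupleSum P W 1 h R` (expand the squares, replace box averages of the divisibility
indicators by the densities `E_{ℤ_D}`, and note that tuples with an entry `> R` or a non-square-free
entry contribute nothing). [cite: GreenTaoAnnals2008, Section 10 eqs. 10.1–10.3] -/
theorem abs_expect_prod_sq_sub_sharpTupleSum_le {R : ℝ} (hR : 1 < R) (W : ℕ) (h : Fin m → ℤ)
    {P : Finset ℕ} (hP : ∀ p ∈ P, p.Prime) (hPR : ∀ p : ℕ, p.Prime → (p : ℝ) ≤ R → p ∈ P)
    (a : ℤ) (ℓ : ℕ) (hℓ : R ^ (2 * m) ≤ ℓ) :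
    |(𝔼 x ∈ Ico a (a + ℓ), ∏ i, truncatedDivisorSum R (W * (x + h i) + 1) ^ 2) -
        sharpTupleSum P W (1 : Fin m → Fin 1 → ℤ) h R| ≤
      Real.log R ^ (2 * m) * (R ^ (2 * m) * (R ^ (2 * m) / ℓ)) := by
  classical
  set L₁ : Fin m → Fin 1 → ℤ := 1 with hL₁
  set K := Real.log R with hK
  have hK0 : 0 < K := Real.log_pos hR
  set c : ℕ → ℝ := fun d => (μ d : ℝ) * lamR R d / K with hc
  set Bx := Fintype.piFinset (fun _ : Fin 1 => Ico a (a + ℓ)) with hBx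
  -- Step 1: rewrite the integrand through `wForm` and `divSum`, on the one-dimensional box
  have h1 : (𝔼 x ∈ Ico a (a + ℓ), ∏ i, truncatedDivisorSum R (W * (x + h i) + 1) ^ 2) =
      𝔼 y ∈ Bx, ∏ i, (K * CFZ.divSum c R (CFZ.wForm W (L₁ i) (h i) y)) ^ 2 := by
    rw [expect_Ico_eq_expect_piFinset]
    refine Finset.expect_congr rfl fun y _ => ?_
    rw [prod_truncatedDivisorSum_sq_eq hR]
  -- Step 2: CFZ expansion and box → density
  have h2 := CFZ.expect_prod_sq_divSum_eq c R K W L₁ h Bx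
  have h3 := CFZ.abs_sum_coef_mul_expect_sub_tupleDensity_le c (fun d => abs_coef_le_one hR d)
    (fun d hd => by simp only [hc]; rw [ArithmeticFunction.moebius_eq_zero_of_not_squarefree hd]; simp)
    hR.le W L₁ h (fun _ => a) (fun _ => ℓ) (fun _ => hℓ)
  simp only [Fin.sum_univ_one] at h3  -- `∑_{j : Fin 1} R^{2m}/ℓ = R^{2m}/ℓ`?
  -- Step 3: the density sum is the sharp tuple sum
  set T := Fintype.piFinset (fun _ : Fin m ⊕ Fin m => squarefreeOf P) with hT
  set Box := Fintype.piFinset (fun _ : Fin m ⊕ Fin m => Icc 1 ⌊R⌋₊) with hBox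
  have hdens : ∑ dd ∈ Box, (∏ v, c (dd v)) *
      tupleDensity W L₁ h (fun j => dd (Sum.inl j)) (fun j => dd (Sum.inr j)) =
      (K ^ (2 * m))⁻¹ * sharpTupleSum P W L₁ h R := by
    -- common value on `Box ∩ T`
    have hval : ∀ dd : Fin m ⊕ Fin m → ℕ, (∏ v, c (dd v)) = (K ^ (2 * m))⁻¹ * ((∏ v, (μ (dd v) : ℝ)) * ∏ v, lamR R (dd v)) := by
      intro dd
      simp only [hc]
      rw [Finset.prod_div_distrib, Finset.prod_mul_distrib, Finset.prod_const, Finset.card_univ,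
        Fintype.card_sum, Fintype.card_fin, ← two_mul]
      field_simp
    unfold sharpTupleSum
    rw [← hT, Finset.mul_sum]
    -- both sums restrict to `Box.filter (· ∈ T)`
    have hBT : ∑ dd ∈ Box, (∏ v, c (dd v)) * tupleDensity W L₁ h (fun j => dd (Sum.inl j)) (fun j => dd (Sum.inr j)) =
        ∑ dd ∈ Box.filter (· ∈ T), (∏ v, c (dd v)) * tupleDensity W L₁ h (fun j => dd (Sum.inl j)) (fun j => dd (Sum.inr j)) := by
      rw [Finset.sum_filter]
      refine Finset.sum_congr rfl fun dd hdd => ?_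
      by_cases hT' : dd ∈ T
      · rw [if_pos hT']
      · rw [if_neg hT']
        -- some entry is not square-free (an entry `≤ R` with prime factors `≤ R`, all in `P`)
        rw [hBox, Fintype.mem_piFinset] at hdd
        rw [hT, Fintype.mem_piFinset] at hT'
        push Not at hT'
        obtain ⟨v, hv⟩ := hT'
        have hdv := hdd v
        rw [Finset.mem_Icc] at hdv
        have hnsq : ¬Squarefree (dd v) := by
          intro hsq
          apply hv
          rw [mem_squarefreeOf hP]
          refine ⟨hsq, fun p hp => hPR p (Nat.prime_of_mem_primeFactors hp) ?_⟩
          have hple : p ≤ dd v := Nat.le_of_dvd hdv.1 (Nat.dvd_of_mem_primeFactors hp)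
          calc (p : ℝ) ≤ dd v := by exact_mod_cast hple
            _ ≤ ⌊R⌋₊ := by exact_mod_cast hdv.2
            _ ≤ R := Nat.floor_le (by linarith)
        have hc0 : c (dd v) = 0 := by
          simp only [hc]; rw [ArithmeticFunction.moebius_eq_zero_of_not_squarefree hnsq]; simp
        rw [Finset.prod_eq_zero (Finset.mem_univ v) hc0, zero_mul]
    have hTB : ∑ dd ∈ T, (K ^ (2 * m))⁻¹ * ((∏ v, (μ (dd v) : ℝ)) *
        tupleDensity W L₁ h (fun j => dd (Sum.inl j)) (fun j => dd (Sum.inr j)) * ∏ v, lamR R (dd v)) =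
        ∑ dd ∈ T.filter (· ∈ Box), (K ^ (2 * m))⁻¹ * ((∏ v, (μ (dd v) : ℝ)) *
        tupleDensity W L₁ h (fun j => dd (Sum.inl j)) (fun j => dd (Sum.inr j)) * ∏ v, lamR R (dd v)) := by
      rw [Finset.sum_filter]
      refine Finset.sum_congr rfl fun dd hdd => ?_
      by_cases hB' : dd ∈ Box
      · rw [if_pos hB']
      · rw [if_neg hB']
        rw [hT, Fintype.mem_piFinset] at hdd
        rw [hBox, Fintype.mem_piFinset] at hB'
        push Not at hB'
        obtain ⟨v, hv⟩ := hB'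
        have h1v : 1 ≤ dd v := one_le_of_mem_squarefreeOf hP (hdd v)
        have hgt : ⌊R⌋₊ < dd v := by
          by_contra hle; push Not at hle
          exact hv (Finset.mem_Icc.2 ⟨h1v, hle⟩)
        have hl0 : lamR R (dd v) = 0 :=
          lamR_eq_zero (by linarith) h1v (le_trans (Nat.lt_floor_add_one R).le (by exact_mod_cast hgt))
        rw [Finset.prod_eq_zero (s := Finset.univ) (f := fun v => lamR R (dd v)) (Finset.mem_univ v) hl0]
        ring
    have hsets : Box.filter (· ∈ T) = T.filter (· ∈ Box) := by
      ext dd; simp only [Finset.mem_filter]; tauto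
    rw [hBT, hTB, hsets]
    refine Finset.sum_congr rfl fun dd _ => ?_
    rw [hval dd]
    ring
  -- Step 4: combine
  rw [h1, h2]
  have hsplit : K ^ (2 * m) * ∑ dd ∈ Box, (∏ v, c (dd v)) *
      (𝔼 x ∈ Fintype.piFinset (fun j : Fin 1 => Ico ((fun _ => a) j) ((fun _ => a) j + ((fun _ => ℓ) j : ℕ))),
        if ∀ j, ((dd (Sum.inl j) : ℤ) ∣ CFZ.wForm W (L₁ j) (h j) x) ∧ ((dd (Sum.inr j) : ℤ) ∣ CFZ.wForm W (L₁ j) (h j) x)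
          then (1 : ℝ) else 0) - sharpTupleSum P W L₁ h R =
      K ^ (2 * m) * ∑ dd ∈ Box, (∏ v, c (dd v)) *
        ((𝔼 x ∈ Fintype.piFinset (fun j : Fin 1 => Ico ((fun _ => a) j) ((fun _ => a) j + ((fun _ => ℓ) j : ℕ))),
          if ∀ j, ((dd (Sum.inl j) : ℤ) ∣ CFZ.wForm W (L₁ j) (h j) x) ∧ ((dd (Sum.inr j) : ℤ) ∣ CFZ.wForm W (L₁ j) (h j) x)
            then (1 : ℝ) else 0) -
          tupleDensity W L₁ h (fun j => dd (Sum.inl j)) (fun j => dd (Sum.inr j))) := by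
    have hK2 : K ^ (2 * m) ≠ 0 := pow_ne_zero _ hK0.ne'
    have : sharpTupleSum P W L₁ h R = K ^ (2 * m) * ∑ dd ∈ Box, (∏ v, c (dd v)) *
        tupleDensity W L₁ h (fun j => dd (Sum.inl j)) (fun j => dd (Sum.inr j)) := by
      rw [hdens, ← mul_assoc, mul_inv_cancel₀ hK2, one_mul]
    rw [this, ← mul_sub, ← Finset.sum_sub_distrib]
    congr 1
    exact Finset.sum_congr rfl fun dd _ => by ring
  have hBx' : Bx = Fintype.piFinset (fun j : Fin 1 => Ico ((fun _ => a) j) ((fun _ => a) j + ((fun _ => ℓ) j : ℕ))) := by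
    rw [hBx]
  rw [← hBx'] at hsplit
  rw [hsplit, abs_mul, abs_of_pos (pow_pos hK0 _)]
  rw [← hBx'] at h3
  exact mul_le_mul_of_nonneg_left h3 (pow_nonneg hK0.le _)

/-! ### The arithmetic of `W = primorial w` -/

/-- `W/φ(W) ≤ e⁵ log w` for `W = primorial w`, `w ≥ 2` (Mertens). [cite: GreenTaoAnnals2008, Section 10 (W/φ(W) ≍ log w)] -/
theorem div_totient_primorial_le {w : ℕ} (hw : 2 ≤ w) :
    (primorial w : ℝ) / (Nat.totient (primorial w) : ℝ) ≤ Real.exp 5 * Real.log w := by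
  have hW0 : (0 : ℝ) < primorial w := by exact_mod_cast primorial_pos w
  have hφ0 : (0 : ℝ) < Nat.totient (primorial w) := by
    exact_mod_cast Nat.totient_pos.2 (primorial_pos w)
  have hprod := CFZ.totient_primorial_div w
  have hmert := LFunctions.MertensBound.exp_neg_div_log_le_prod_one_sub_inv w hw
  have hw2 : (2 : ℝ) ≤ w := by exact_mod_cast hw
  have hlog : 0 < Real.log w := Real.log_pos (by linarith)
  -- `φ(W)/W = ∏_{p ≤ w}(1 - 1/p) ≥ e^{-5}/log w`
  have hge : Real.exp (-5) / Real.log w ≤ (Nat.totient (primorial w) : ℝ) / primorial w := by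
    rw [hprod]
    refine hmert.trans (le_of_eq ?_)
    refine Finset.prod_congr rfl fun p _ => ?_
    rw [one_div]
  rw [div_le_iff₀ hφ0]
  have h1 : Real.exp (-5) / Real.log w * primorial w ≤ Nat.totient (primorial w) := by
    rw [le_div_iff₀ hW0] at hge; exact hge
  have h2 : Real.exp 5 * Real.log w * (Real.exp (-5) / Real.log w * primorial w) = primorial w := by
    rw [Real.exp_neg]; field_simp
  calc (primorial w : ℝ) = Real.exp 5 * Real.log w * (Real.exp (-5) / Real.log w * primorial w) := h2.symm
    _ ≤ Real.exp 5 * Real.log w * Nat.totient (primorial w) :=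
        mul_le_mul_of_nonneg_left h1 (by positivity)

/-- `Π_W(1/2) = ∏_{p ≤ w} (1 - p^{-1/2})⁻¹ ≤ 4^w`. [folklore] -/
theorem rankinProd_primorial_le (w : ℕ) : rankinProd (1 / 2) (primorial w) ≤ 4 ^ w := by
  unfold rankinProd
  rw [primeFactors_primorial]
  have hfac : ∀ p ∈ Nat.primesLE w, (1 - (p : ℝ) ^ (-(1 / 2 : ℝ)))⁻¹ ≤ 4 := by
    intro p hp
    have hp2 : (2 : ℝ) ≤ p := by exact_mod_cast (Nat.mem_primesLE.1 hp).2.two_le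
    have hx : (p : ℝ) ^ (-(1 / 2 : ℝ)) ≤ 3 / 4 := by
      rw [Real.rpow_neg (by linarith), ← Real.sqrt_eq_rpow,
        inv_le_comm₀ (Real.sqrt_pos.2 (by linarith)) (by norm_num), Real.le_sqrt (by norm_num) (by linarith)]
      nlinarith
    have hx0 : 0 ≤ (p : ℝ) ^ (-(1 / 2 : ℝ)) := by positivity
    rw [inv_le_comm₀ (by linarith) (by norm_num)]
    linarith
  have hfac0 : ∀ p ∈ Nat.primesLE w, 0 ≤ (1 - (p : ℝ) ^ (-(1 / 2 : ℝ)))⁻¹ := by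
    intro p hp
    have hp2 : (2 : ℝ) ≤ p := by exact_mod_cast (Nat.mem_primesLE.1 hp).2.two_le
    have : (p : ℝ) ^ (-(1 / 2 : ℝ)) ≤ 1 := Real.rpow_le_one_of_one_le_of_nonpos (by linarith) (by norm_num)
    have : (p : ℝ) ^ (-(1 / 2 : ℝ)) < 1 := by
      rw [Real.rpow_neg (by linarith)]
      exact inv_lt_one_of_one_lt₀ (Real.one_lt_rpow (by linarith) (by norm_num))
    exact inv_nonneg.2 (by linarith)
  calc ∏ p ∈ Nat.primesLE w, (1 - (p : ℝ) ^ (-(1 / 2 : ℝ)))⁻¹ ≤ ∏ _p ∈ Nat.primesLE w, (4 : ℝ) :=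
        Finset.prod_le_prod hfac0 hfac
    _ = 4 ^ (Nat.primesLE w).card := Finset.prod_const _
    _ ≤ 4 ^ w := by
        refine pow_le_pow_right₀ (by norm_num) ?_
        have hsub : Nat.primesLE w ⊆ Finset.Icc 2 w := by
          intro p hp
          have := Nat.mem_primesLE.1 hp
          exact Finset.mem_Icc.2 ⟨this.2.two_le, this.1⟩
        calc (Nat.primesLE w).card ≤ (Finset.Icc 2 w).card := Finset.card_le_card hsub
          _ = w + 1 - 2 := Nat.card_Icc 2 w
          _ ≤ w := by omega

/-- `∑_{p ≤ w} log p / p ≤ w` (`log p ≤ p`). [folklore] -/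
theorem sum_log_div_primorial_le (w : ℕ) :
    ∑ p ∈ (primorial w).primeFactors, Real.log p / p ≤ w := by
  rw [primeFactors_primorial]
  have hsub : Nat.primesLE w ⊆ Finset.Icc 1 w := by
    intro p hp
    have := Nat.mem_primesLE.1 hp
    exact Finset.mem_Icc.2 ⟨this.2.one_lt.le, this.1⟩
  calc ∑ p ∈ Nat.primesLE w, Real.log p / p ≤ ∑ p ∈ Finset.Icc 1 w, Real.log p / p :=
        Finset.sum_le_sum_of_subset_of_nonneg hsub fun p hp _ => by
          have : (1 : ℝ) ≤ p := by exact_mod_cast (Finset.mem_Icc.1 hp).1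
          exact div_nonneg (Real.log_nonneg this) (by linarith)
    _ ≤ ∑ _p ∈ Finset.Icc 1 w, (1 : ℝ) := by
        refine Finset.sum_le_sum fun p hp => ?_
        have hp1 : (1 : ℝ) ≤ p := by exact_mod_cast (Finset.mem_Icc.1 hp).1
        rw [div_le_one (by linarith)]
        exact (Real.log_le_sub_one_of_pos (by linarith)).trans (by linarith)
    _ = w := by simp

/-- Every prime not dividing `primorial w` exceeds `w`. [folklore] -/
theorem lt_of_not_dvd_primorial {p w : ℕ} (hp : p.Prime) (h : ¬ p ∣ primorial w) : w < p := by
  by_contra hle; push Not at hle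
  exact h ((Nat.Prime.dvd_primorial_iff hp).2 hle)

/-! ### The discriminant `Δ = ∏_{i<j} |h_i - h_j|` -/

/-- A prime dividing some `h_i - h_j` (`i ≠ j`) divides `Δ = ∏_{i<j} |h_i - h_j| ≠ 0` (`h` injective).
[cite: GreenTaoAnnals2008, Proposition 9.6] -/
theorem mem_primeFactors_discr {h : Fin m → ℤ} (hinj : Function.Injective h) {p : ℕ} (hp : p.Prime)
    {i j : Fin m} (hij : i ≠ j) (hdvd : (p : ℤ) ∣ h i - h j) :
    p ∈ (∏ i, ∏ j ∈ univ.filter (fun j => i < j), |h i - h j|).natAbs.primeFactors := by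
  have hne : (∏ i, ∏ j ∈ univ.filter (fun j => i < j), |h i - h j|) ≠ 0 := by
    refine Finset.prod_ne_zero_iff.2 fun i _ => Finset.prod_ne_zero_iff.2 fun j hj => ?_
    have hlt := (Finset.mem_filter.1 hj).2
    exact abs_ne_zero.2 (sub_ne_zero.2 fun heq => (ne_of_lt hlt) (hinj heq))
  refine Nat.mem_primeFactors.2 ⟨hp, ?_, Int.natAbs_ne_zero.2 hne⟩
  rw [← Int.natCast_dvd]
  -- order the pair
  rcases lt_or_gt_of_ne hij with hlt | hlt
  · refine dvd_trans ?_ (Finset.dvd_prod_of_mem _ (Finset.mem_univ i))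
    refine dvd_trans ?_ (Finset.dvd_prod_of_mem _ (Finset.mem_filter.2 ⟨Finset.mem_univ j, hlt⟩))
    exact (dvd_abs _ _).2 hdvd
  · refine dvd_trans ?_ (Finset.dvd_prod_of_mem _ (Finset.mem_univ j))
    refine dvd_trans ?_ (Finset.dvd_prod_of_mem _ (Finset.mem_filter.2 ⟨Finset.mem_univ i, hlt⟩))
    exact (dvd_abs _ _).2 (dvd_sub_comm.1 hdvd)

/-- `∏ (1 + C/p) ≤ ∏ (1 + C p^{-1/2})` over a set of primes (`1/p ≤ p^{-1/2}`). [folklore] -/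
theorem prod_one_add_div_le_prod_rpow {S : Finset ℕ} (hS : ∀ p ∈ S, p.Prime) {C : ℝ} (hC0 : 0 ≤ C) :
    ∏ p ∈ S, (1 + C * (1 / (p : ℝ))) ≤ ∏ p ∈ S, (1 + C * (p : ℝ) ^ (-(1 / 2 : ℝ))) := by
  refine Finset.prod_le_prod (fun p _ => ?_) fun p hp => ?_
  · have : 0 ≤ C * (1 / (p : ℝ)) := by positivity
    linarith
  · have hp1 : (1 : ℝ) ≤ p := by exact_mod_cast (hS p hp).one_lt.le
    have hinv : 1 / (p : ℝ) ≤ (p : ℝ) ^ (-(1 / 2 : ℝ)) := by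
      rw [Real.rpow_neg (by linarith), one_div]
      refine inv_anti₀ (by positivity) ?_
      calc (p : ℝ) ^ (1 / 2 : ℝ) ≤ (p : ℝ) ^ (1 : ℝ) := Real.rpow_le_rpow_of_exponent_le hp1 (by norm_num)
        _ = p := Real.rpow_one _
    exact add_le_add le_rfl (mul_le_mul_of_nonneg_left hinv hC0)

/-- `1 ≤ ∏ (1 + C p^{-1/2})`. [folklore] -/
theorem one_le_prod_one_add_rpow (S : Finset ℕ) {C : ℝ} (hC0 : 0 ≤ C) :
    1 ≤ ∏ p ∈ S, (1 + C * (p : ℝ) ^ (-(1 / 2 : ℝ))) := by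
  have := Finset.prod_le_prod (s := S) (f := fun _ : ℕ => (1 : ℝ)) (g := fun p : ℕ => 1 + C * (p : ℝ) ^ (-(1 / 2 : ℝ)))
    (fun _ _ => zero_le_one) (fun p _ => by
      have : 0 ≤ C * (p : ℝ) ^ (-(1 / 2 : ℝ)) := by positivity
      linarith)
  simpa using this

/-! ### The deterministic estimate -/

set_option maxHeartbeats 1600000 in
/-- **Proposition 9.6, quantitative form.** For `W = primorial w` (`w ≥ 2`), `R ≥ e` with
`C_G (7 + w) ≤ log R`, distinct shifts `h_i` and an interval `[a, a+ℓ)` with `ℓ ≥ R^{10m}`: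
`E_{x} ∏_i Λ_R(W(x+h_i)+1)² ≤ (1 + T) (W log R/φ(W))^m ∏_{p ∣ Δ}(1 + C p^{-1/2})` with
`1 + T = (1 + 3K 4^w/log R + 8e⁵ (log w)/w)^m + (2B²)^m (exp(16^m/w) - 1) + R^{-4m}` and
`C = (2B²)^m · 2 · 16^m` (`B = sup|M|`, `K` the two-level constant, `C_G` the GGPY constant).
[cite: GreenTaoAnnals2008, Proposition 9.6 and Section 10] -/
theorem expect_prod_sq_le {B Kd C_G : ℝ} (hB1 : 1 ≤ B) (hB : ∀ y, |moebLog y| ≤ B) (hKd0 : 0 ≤ Kd)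
    (hdiag : ∀ (q w : ℕ), q ≠ 0 → 1 ≤ w → (∀ p : ℕ, p.Prime → p ≤ w → p ∣ q) →
      ∀ R₁ R₂ : ℝ, 1 ≤ R₁ → R₁ ≤ R₂ →
        |diagSum q R₁ R₂ - (q : ℝ) / q.totient * Real.log R₁| ≤
          (q : ℝ) / q.totient * ((Kd * (1 + ∑ p ∈ q.primeFactors, Real.log p / p + rankinProd (1 / 2) q)) +
            4 * ((q : ℝ) / q.totient) * (1 + Real.log R₁) / w))
    (hCG0 : 0 ≤ C_G)
    (hG : ∀ q : ℕ, q ≠ 0 → ∀ y : ℝ, 1 ≤ y →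
      |invTotSum q y - (q.totient : ℝ) / q * Real.log y| ≤
        (q.totient : ℝ) / q * (C_G * (7 + ∑ p ∈ q.primeFactors, Real.log p / p)))
    {w : ℕ} (hw : 2 ≤ w) {R : ℝ} (hR : Real.exp 1 ≤ R) (hη₂ : C_G * (7 + w) ≤ Real.log R)
    {h : Fin m → ℤ} (hinj : Function.Injective h) (a : ℤ) (ℓ : ℕ) (hℓ : R ^ (10 * m) ≤ ℓ) :
    𝔼 x ∈ Ico a (a + ℓ), ∏ i, truncatedDivisorSum R (primorial w * (x + h i) + 1) ^ 2 ≤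
      ((1 + 3 * Kd * 4 ^ w / Real.log R + 8 * Real.exp 5 * Real.log w / w) ^ m +
          (2 * B ^ 2) ^ m * (Real.exp (16 ^ m / w) - 1) + R ^ (-(4 * (m : ℝ)))) *
        ((primorial w : ℝ) * Real.log R / Nat.totient (primorial w)) ^ m *
        ∏ p ∈ (∏ i, ∏ j ∈ univ.filter (fun j => i < j), |h i - h j|).natAbs.primeFactors,
          (1 + (2 * B ^ 2) ^ m * (2 * 16 ^ m) * (p : ℝ) ^ (-(1 / 2 : ℝ))) := by
  classical
  -- basic quantities
  set W := primorial w with hWdef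
  have hW : W ≠ 0 := primorial_ne_zero w
  have hW0 : (0 : ℝ) < W := by exact_mod_cast primorial_pos w
  have hφ0 : (0 : ℝ) < Nat.totient W := by exact_mod_cast Nat.totient_pos.2 (primorial_pos w)
  set PW : ℝ := (W : ℝ) / (Nat.totient W : ℝ) with hPW
  have hPW1 : 1 ≤ PW := one_le_div_totient hW
  have hPW0 : 0 < PW := by linarith
  have hR1 : 1 < R := lt_of_lt_of_le (by have := Real.add_one_le_exp (1:ℝ); linarith) hR
  have hR0 : 0 < R := by linarith
  set lR := Real.log R with hlR
  have hlR1 : 1 ≤ lR := by rw [hlR, ← Real.log_exp 1]; exact Real.log_le_log (Real.exp_pos 1) hR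
  have hlR0 : 0 < lR := by linarith
  have hw1 : 1 ≤ w := by omega
  have hw0 : (0 : ℝ) < w := by exact_mod_cast (show 0 < w by omega)
  have hw2 : (2 : ℝ) ≤ w := by exact_mod_cast hw
  have hlogw0 : 0 ≤ Real.log w := Real.log_nonneg (by linarith)
  set M := PW * lR with hM
  have hM1 : 1 ≤ M := by rw [hM]; nlinarith
  have hM0 : 0 < M := by linarith
  -- Mertens-type inputs
  have hPWle : PW ≤ Real.exp 5 * Real.log w := div_totient_primorial_le hw
  have hLW : ∑ p ∈ W.primeFactors, Real.log p / p ≤ w := sum_log_div_primorial_le w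
  have hLW0 : 0 ≤ ∑ p ∈ W.primeFactors, Real.log p / p := Finset.sum_nonneg fun p hp => by
    have : (1 : ℝ) ≤ p := by exact_mod_cast (Nat.prime_of_mem_primeFactors hp).one_lt.le
    exact div_nonneg (Real.log_nonneg this) (by linarith)
  have hPiW : rankinProd (1 / 2) W ≤ 4 ^ w := rankinProd_primorial_le w
  have h4w : (1 : ℝ) ≤ 4 ^ w := one_le_pow₀ (by norm_num)
  have hw4 : (w : ℝ) ≤ 4 ^ w := by
    have : (w : ℝ) ≤ 2 ^ w := by exact_mod_cast (Nat.lt_two_pow_self).le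
    exact this.trans (pow_le_pow_left₀ (by norm_num) (by norm_num) w)
  -- the prime set
  set P := Nat.primesBelow (⌈R⌉₊ + W + 1) with hPdef
  have hP : ∀ p ∈ P, p.Prime := fun p hp => Nat.prime_of_mem_primesBelow hp
  have hPW' : ∀ p : ℕ, p.Prime → p ∣ W → p ∈ P := fun p hp hpW =>
    Nat.mem_primesBelow.2 ⟨by have := Nat.le_of_dvd (primorial_pos w) hpW; omega, hp⟩
  have hPR : ∀ p : ℕ, p.Prime → (p : ℝ) ≤ R → p ∈ P := fun p hp hpR => by
    refine Nat.mem_primesBelow.2 ⟨?_, hp⟩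
    have : p ≤ ⌈R⌉₊ := by
      have h1 : (p : ℝ) ≤ ⌈R⌉₊ := hpR.trans (Nat.le_ceil R)
      exact_mod_cast h1
    omega
  clear_value P
  set L₁ : Fin m → Fin 1 → ℤ := 1 with hL₁
  -- Step 1: front end
  have hℓ2 : R ^ (2 * m) ≤ ℓ := le_trans (pow_le_pow_right₀ hR1.le (by omega)) hℓ
  have hfront := abs_expect_prod_sq_sub_sharpTupleSum_le hR1 W h hP hPR a ℓ hℓ2
  have hℓ0 : (0 : ℝ) < ℓ := lt_of_lt_of_le (pow_pos hR0 _) hℓ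
  have herr₁ : Real.log R ^ (2 * m) * (R ^ (2 * m) * (R ^ (2 * m) / ℓ)) ≤ R ^ (-(4 * (m : ℝ))) := by
    have hlogR : Real.log R ≤ R := (Real.log_le_sub_one_of_pos hR0).trans (by linarith)
    have h1 : Real.log R ^ (2 * m) ≤ R ^ (2 * m) := pow_le_pow_left₀ hlR0.le hlogR _
    have h2 : R ^ (2 * m) / ℓ ≤ R ^ (2 * m) / R ^ (10 * m) := div_le_div_of_nonneg_left (by positivity) (pow_pos hR0 _) hℓ
    calc Real.log R ^ (2 * m) * (R ^ (2 * m) * (R ^ (2 * m) / ℓ))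
        ≤ R ^ (2 * m) * (R ^ (2 * m) * (R ^ (2 * m) / R ^ (10 * m))) := by gcongr
      _ = R ^ (-(4 * (m : ℝ))) := by
          have hR4 : R ^ (-(4 * (m : ℝ))) = (R ^ (4 * m))⁻¹ := by
            rw [Real.rpow_neg hR0.le, show (4 * (m : ℝ)) = ((4 * m : ℕ) : ℝ) by push_cast; ring,
              Real.rpow_natCast]
          rw [hR4]
          simp only [pow_mul']
          have hX : R ^ m ≠ 0 := pow_ne_zero _ hR0.ne'
          field_simp
  -- Step 2: the expansion around the model
  set bad : ℕ → Prop := fun p => ∃ i j : Fin m, i ≠ j ∧ (p : ℤ) ∣ h i - h j with hbad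
  set γ : ℕ → ℝ := fun p => if bad p then 2 * 4 ^ m / (p : ℝ) else 4 ^ m / (p : ℝ) ^ 2 with hγ
  have hγ0 : ∀ p ∈ P, 0 ≤ γ p := fun p _ => by simp only [hγ]; split_ifs <;> positivity
  have hγb : ∀ p ∈ P, ¬ p ∣ W → ∑ Y : Finset (Fin m ⊕ Fin m), |locD p W L₁ h Y| ≤ γ p := by
    intro p hp hpW
    haveI : Fact p.Prime := ⟨hP p hp⟩
    simp only [hγ]
    split_ifs with hb
    · exact sum_abs_locD_one_le hpW h
    · have hgen : ∀ i j : Fin m, i ≠ j → ¬ (p : ℤ) ∣ h i - h j := fun i j hij hd => hb ⟨i, j, hij, hd⟩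
      exact sum_abs_locD_one_le_of_generic hpW hgen
  have hexp := abs_sharpTupleSum_one_sub_pow_le hP hW h hPW' hR1.le hPR hB hγ0 hγb
  set K₀ : ℝ := B ^ 2 * PW ^ 2 * invTotSum W R with hK₀
  have hK00 : 0 ≤ K₀ := by have := invTotSum_nonneg W R; positivity
  set Pc := ∏ p ∈ P, (1 + (if p ∣ W then 0 else 4 ^ m * γ p)) with hPc
  -- Step 3: the main term `D = S₁(W; R, R)`
  set D := diagSum W R R with hD
  set η₁ : ℝ := 3 * Kd * 4 ^ w / lR + 8 * Real.exp 5 * Real.log w / w with hη₁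
  have hη₁0 : 0 ≤ η₁ := by positivity
  have hDle : |D| ≤ M * (1 + η₁) := by
    have hd := hdiag W w hW hw1 (fun p hp hpw => (Nat.Prime.dvd_primorial_iff hp).2 hpw) R R hR1.le le_rfl
    rw [← hPW, ← hD] at hd
    have h1 : |D| ≤ PW * lR + PW * (Kd * (1 + ∑ p ∈ W.primeFactors, Real.log p / p + rankinProd (1 / 2) W) +
        4 * PW * (1 + lR) / w) := by
      have := abs_sub_abs_le_abs_sub D (PW * lR)
      rw [abs_of_pos (by positivity : 0 < PW * lR)] at this
      linarith
    refine h1.trans ?_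
    have h2 : Kd * (1 + ∑ p ∈ W.primeFactors, Real.log p / p + rankinProd (1 / 2) W) ≤ 3 * Kd * 4 ^ w := by
      have : 1 + ∑ p ∈ W.primeFactors, Real.log p / p + rankinProd (1 / 2) W ≤ 3 * 4 ^ w := by linarith
      nlinarith
    have h3 : 4 * PW * (1 + lR) / w ≤ 8 * Real.exp 5 * Real.log w / w * lR := by
      rw [div_le_iff₀ hw0]
      have : 4 * PW * (1 + lR) ≤ 4 * (Real.exp 5 * Real.log w) * (2 * lR) := by
        have h1lR : 1 + lR ≤ 2 * lR := by linarith
        calc 4 * PW * (1 + lR) ≤ 4 * PW * (2 * lR) := by nlinarith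
          _ ≤ 4 * (Real.exp 5 * Real.log w) * (2 * lR) := by nlinarith
      calc 4 * PW * (1 + lR) ≤ 4 * (Real.exp 5 * Real.log w) * (2 * lR) := this
        _ = 8 * Real.exp 5 * Real.log w / w * lR * w := by field_simp; ring
    calc PW * lR + PW * (Kd * (1 + ∑ p ∈ W.primeFactors, Real.log p / p + rankinProd (1 / 2) W) + 4 * PW * (1 + lR) / w)
        ≤ PW * lR + PW * (3 * Kd * 4 ^ w + 8 * Real.exp 5 * Real.log w / w * lR) := by
          have := add_le_add h2 h3
          nlinarith
      _ = M * (1 + η₁) := by rw [hM, hη₁]; field_simp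
  have hDm : D ^ m ≤ M ^ m * (1 + η₁) ^ m := by
    calc D ^ m ≤ |D ^ m| := le_abs_self _
      _ = |D| ^ m := abs_pow D m
      _ ≤ (M * (1 + η₁)) ^ m := pow_le_pow_left₀ (abs_nonneg D) hDle m
      _ = M ^ m * (1 + η₁) ^ m := mul_pow _ _ _
  -- Step 4: the crude constant `K₀ ≤ 2B² M`
  set Kc : ℝ := (2 * B ^ 2) ^ m with hKc
  have hB2 : 1 ≤ B ^ 2 := by nlinarith
  have hKc1 : 1 ≤ Kc := one_le_pow₀ (by nlinarith)
  have hK₀le : K₀ ≤ 2 * B ^ 2 * M := by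
    have hg := hG W hW R hR1.le
    have hφW : (Nat.totient W : ℝ) / W = PW⁻¹ := by rw [hPW, inv_div]
    rw [hφW] at hg
    have h1 : invTotSum W R ≤ PW⁻¹ * lR + PW⁻¹ * (C_G * (7 + ∑ p ∈ W.primeFactors, Real.log p / p)) := by
      have := abs_sub_abs_le_abs_sub (invTotSum W R) (PW⁻¹ * lR)
      rw [abs_of_nonneg (invTotSum_nonneg W R)] at this
      have h' : |PW⁻¹ * lR| = PW⁻¹ * lR := abs_of_pos (by positivity)
      linarith
    have h2 : C_G * (7 + ∑ p ∈ W.primeFactors, Real.log p / p) ≤ lR := by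
      calc C_G * (7 + ∑ p ∈ W.primeFactors, Real.log p / p) ≤ C_G * (7 + w) := by nlinarith
        _ ≤ lR := hη₂
    have h3 : invTotSum W R ≤ PW⁻¹ * (2 * lR) := by
      have : PW⁻¹ * (C_G * (7 + ∑ p ∈ W.primeFactors, Real.log p / p)) ≤ PW⁻¹ * lR :=
        mul_le_mul_of_nonneg_left h2 (by positivity)
      linarith
    calc K₀ = B ^ 2 * PW ^ 2 * invTotSum W R := rfl
      _ ≤ B ^ 2 * PW ^ 2 * (PW⁻¹ * (2 * lR)) := mul_le_mul_of_nonneg_left h3 (by positivity)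
      _ = 2 * B ^ 2 * M := by rw [hM]; field_simp
  have hK₀m : K₀ ^ m ≤ Kc * M ^ m := by
    calc K₀ ^ m ≤ (2 * B ^ 2 * M) ^ m := pow_le_pow_left₀ hK00 hK₀le m
      _ = Kc * M ^ m := by rw [hKc, mul_pow]
  -- Step 5: the Euler product of the discrepancies
  set g : ℕ → ℝ := fun p => if p ∣ W then 0 else 16 ^ m / (p : ℝ) ^ 2 with hg
  set b : ℕ → ℝ := fun p => if ¬ p ∣ W ∧ bad p then 2 * 16 ^ m / (p : ℝ) else 0 with hb
  have hg0 : ∀ p, 0 ≤ g p := fun p => by simp only [hg]; split_ifs <;> positivity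
  have hb0 : ∀ p, 0 ≤ b p := fun p => by simp only [hb]; split_ifs <;> positivity
  have h16 : (16 : ℝ) ^ m = 4 ^ m * 4 ^ m := by rw [← mul_pow]; norm_num
  have hcle : ∀ p ∈ P, 1 + (if p ∣ W then 0 else 4 ^ m * γ p) ≤ (1 + g p) * (1 + b p) := by
    intro p _
    by_cases hpW : p ∣ W
    · simp [hg, hb, hpW]
    · simp only [hg, hb, hγ, if_neg hpW]
      by_cases hbp : bad p
      · rw [if_pos hbp, if_pos ⟨hpW, hbp⟩]
        have : 4 ^ m * (2 * 4 ^ m / (p : ℝ)) = 2 * 16 ^ m / p := by rw [h16]; ring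
        rw [this]
        have h0 : 0 ≤ 16 ^ m / (p : ℝ) ^ 2 := by positivity
        have h0' : 0 ≤ 2 * 16 ^ m / (p : ℝ) := by positivity
        nlinarith
      · rw [if_neg hbp, if_neg (fun h' => hbp h'.2)]
        have : 4 ^ m * (4 ^ m / (p : ℝ) ^ 2) = 16 ^ m / (p : ℝ) ^ 2 := by rw [h16]; ring
        rw [this]; linarith
  have hPc_le : Pc ≤ (∏ p ∈ P, (1 + g p)) * ∏ p ∈ P, (1 + b p) := by
    rw [← Finset.prod_mul_distrib]
    refine Finset.prod_le_prod (fun p hp => ?_) hcle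
    have := hγ0 p hp
    split_ifs <;> positivity
  have hAg : ∏ p ∈ P, (1 + g p) ≤ Real.exp (16 ^ m / w) := by
    have h1 : ∏ p ∈ P, (1 + g p) ≤ Real.exp (∑ p ∈ P, g p) := by
      rw [Real.exp_sum]
      exact Finset.prod_le_prod (fun p _ => by linarith [hg0 p]) fun p _ => by linarith [Real.add_one_le_exp (g p)]
    refine h1.trans (Real.exp_le_exp.2 ?_)
    have hsplit : ∑ p ∈ P, g p = 16 ^ m * ∑ p ∈ P.filter (fun p => ¬ p ∣ W), 1 / (p : ℝ) ^ 2 := by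
      rw [Finset.sum_filter, Finset.mul_sum]
      refine Finset.sum_congr rfl fun p _ => ?_
      by_cases hpW : p ∣ W
      · simp [hg, hpW]
      · simp [hg, hpW]; ring
    rw [hsplit]
    have hWw : ∀ p : ℕ, p.Prime → ¬ p ∣ W → w < p := fun p hp hpW => lt_of_not_dvd_primorial hp hpW
    have := sum_inv_sq_filter_le hP hW hw1 hWw
    calc 16 ^ m * ∑ p ∈ P.filter (fun p => ¬ p ∣ W), 1 / (p : ℝ) ^ 2 ≤ 16 ^ m * (1 / (w : ℝ)) :=
          mul_le_mul_of_nonneg_left this (by positivity)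
      _ = 16 ^ m / w := by ring
  set ε' : ℝ := Real.exp (16 ^ m / w) - 1 with hε'
  have hε'0 : 0 ≤ ε' := by
    have : (1 : ℝ) ≤ Real.exp (16 ^ m / w) := Real.one_le_exp (by positivity)
    linarith
  set Ab := ∏ p ∈ P, (1 + b p) with hAb
  have hAb1 : 1 ≤ Ab := by
    have := Finset.prod_le_prod (s := P) (f := fun _ => (1 : ℝ)) (g := fun p => 1 + b p)
      (fun _ _ => zero_le_one) (fun p _ => by linarith [hb0 p])
    simpa using this
  set Φ := ∏ p ∈ P, (1 + Kc * b p) with hΦ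
  have hΦkey : 1 + Kc * (Ab - 1) ≤ Φ := one_add_mul_prod_sub_one_le P hKc1 fun p _ => hb0 p
  have hAbΦ : Ab ≤ Φ := Finset.prod_le_prod (fun p _ => by linarith [hb0 p]) fun p _ => by
    have := hb0 p; nlinarith
  have hΦ1 : 1 ≤ Φ := hAb1.trans hAbΦ
  have hAg1 : 1 ≤ ∏ p ∈ P, (1 + g p) := by
    have := Finset.prod_le_prod (s := P) (f := fun _ => (1 : ℝ)) (g := fun p => 1 + g p)
      (fun _ _ => zero_le_one) (fun p _ => by linarith [hg0 p])
    simpa using this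
  clear_value Pc K₀ Φ Ab ε' Kc η₁ M D γ g b
  -- Step 6: the sharp tuple sum
  have hMm : 0 ≤ M ^ m := pow_nonneg hM0.le m
  have hpow1' : 1 ≤ (1 + η₁) ^ m := one_le_pow₀ (by linarith)
  have hS : sharpTupleSum P W L₁ h R ≤ M ^ m * Φ * ((1 + η₁) ^ m + Kc * ε') := by
    have h1 : sharpTupleSum P W L₁ h R ≤ D ^ m + (Pc - 1) * K₀ ^ m := by
      have := (abs_le.1 hexp).2; linarith
    have hPc1 : 1 ≤ Pc := by
      rw [hPc]
      have := Finset.prod_le_prod (s := P) (f := fun _ => (1 : ℝ)) (g := fun p => 1 + (if p ∣ W then 0 else 4 ^ m * γ p))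
        (fun _ _ => zero_le_one) (fun p hp => by
          have h0 : 0 ≤ (if p ∣ W then (0 : ℝ) else 4 ^ m * γ p) := by
            split_ifs
            · exact le_rfl
            · exact mul_nonneg (by positivity) (hγ0 p hp)
          linarith)
      simpa using this
    have hAgAb1 : 1 ≤ (∏ p ∈ P, (1 + g p)) * Ab := by nlinarith
    have h2 : (Pc - 1) * K₀ ^ m ≤ ((∏ p ∈ P, (1 + g p)) * Ab - 1) * (Kc * M ^ m) :=
      mul_le_mul (by linarith [hPc_le]) hK₀m (pow_nonneg hK00 m) (by linarith)
    have h3 : Kc * ((∏ p ∈ P, (1 + g p)) * Ab - 1) ≤ (Φ - 1) + Kc * Φ * ε' := by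
      have hAgε : (∏ p ∈ P, (1 + g p)) ≤ 1 + ε' := by rw [hε']; linarith
      have e1 : Kc * ((∏ p ∈ P, (1 + g p)) * Ab - 1) = Kc * (Ab - 1) + Kc * Ab * ((∏ p ∈ P, (1 + g p)) - 1) := by ring
      rw [e1]
      have hKc0 : 0 ≤ Kc := le_trans zero_le_one hKc1
      have e2 : Kc * Ab * ((∏ p ∈ P, (1 + g p)) - 1) ≤ Kc * Φ * ε' :=
        mul_le_mul (mul_le_mul_of_nonneg_left hAbΦ hKc0) (sub_le_iff_le_add'.2 hAgε) (sub_nonneg.2 hAg1)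
          (mul_nonneg hKc0 (le_trans zero_le_one hΦ1))
      linarith [hΦkey, e2]
    have hpow1 : 1 ≤ (1 + η₁) ^ m := one_le_pow₀ (by linarith)
    have key : 0 ≤ (Φ - 1) * ((1 + η₁) ^ m - 1) := mul_nonneg (sub_nonneg.2 hΦ1) (sub_nonneg.2 hpow1)
    have h4 : (1 + η₁) ^ m + ((Φ - 1) + Kc * Φ * ε') ≤ Φ * ((1 + η₁) ^ m + Kc * ε') := by
      have e : Φ * ((1 + η₁) ^ m + Kc * ε') - ((1 + η₁) ^ m + ((Φ - 1) + Kc * Φ * ε')) =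
          (Φ - 1) * ((1 + η₁) ^ m - 1) := by ring
      exact sub_nonneg.1 (e ▸ key)
    calc sharpTupleSum P W L₁ h R ≤ D ^ m + (Pc - 1) * K₀ ^ m := h1
      _ ≤ M ^ m * (1 + η₁) ^ m + ((∏ p ∈ P, (1 + g p)) * Ab - 1) * (Kc * M ^ m) := add_le_add hDm h2
      _ = M ^ m * ((1 + η₁) ^ m + Kc * ((∏ p ∈ P, (1 + g p)) * Ab - 1)) := by ring
      _ ≤ M ^ m * ((1 + η₁) ^ m + ((Φ - 1) + Kc * Φ * ε')) := mul_le_mul_of_nonneg_left (add_le_add le_rfl h3) hMm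
      _ ≤ M ^ m * (Φ * ((1 + η₁) ^ m + Kc * ε')) := mul_le_mul_of_nonneg_left h4 hMm
      _ = M ^ m * Φ * ((1 + η₁) ^ m + Kc * ε') := by ring
  -- Step 7: `Φ ≤ ∏_{p ∣ Δ} (1 + C p^{-1/2})`
  set C : ℝ := Kc * (2 * 16 ^ m) with hC
  set Δs := (∏ i, ∏ j ∈ univ.filter (fun j => i < j), |h i - h j|).natAbs.primeFactors with hΔs
  have hKc0 : 0 ≤ Kc := le_trans zero_le_one hKc1
  have hC0 : 0 ≤ C := mul_nonneg hKc0 (by positivity)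
  set Sbad := P.filter (fun p => ¬ p ∣ W ∧ bad p) with hSbad
  have hSp : ∀ p ∈ Sbad, p.Prime := fun p hp => hP p (Finset.mem_filter.1 hp).1
  have hΦle : Φ ≤ ∏ p ∈ Δs, (1 + C * (p : ℝ) ^ (-(1 / 2 : ℝ))) := by
    have hΦeq : Φ = ∏ p ∈ Sbad, (1 + C * (1 / (p : ℝ))) := by
      rw [hΦ, hSbad, Finset.prod_filter]
      refine Finset.prod_congr rfl fun p _ => ?_
      simp only [hb]
      split_ifs
      · rw [hC]; ring
      · simp
    rw [hΦeq]
    have hsub : Sbad ⊆ Δs := by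
      intro p hp
      have hp' := Finset.mem_filter.1 hp
      obtain ⟨i, j, hij, hd⟩ := hp'.2.2
      exact mem_primeFactors_discr hinj (hP p hp'.1) hij hd
    refine (prod_one_add_div_le_prod_rpow hSp hC0).trans ?_
    rw [← Finset.prod_sdiff hsub]
    exact le_mul_of_one_le_left (le_trans zero_le_one (one_le_prod_one_add_rpow _ hC0))
      (one_le_prod_one_add_rpow _ hC0)
  -- Step 8: combine
  set Ψ := ∏ p ∈ Δs, (1 + C * (p : ℝ) ^ (-(1 / 2 : ℝ))) with hΨ
  have hΨ1 : 1 ≤ Ψ := one_le_prod_one_add_rpow _ hC0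
  clear_value Ψ
  have hE : (𝔼 x ∈ Ico a (a + ℓ), ∏ i, truncatedDivisorSum R (W * (x + h i) + 1) ^ 2) ≤
      sharpTupleSum P W L₁ h R + R ^ (-(4 * (m : ℝ))) := by
    have := (abs_le.1 hfront).2; linarith
  have hMeq : ((W : ℝ) * Real.log R / Nat.totient W) = M := by rw [hM, hPW, hlR]; ring
  rw [hMeq]
  have hMm1 : 1 ≤ M ^ m := one_le_pow₀ hM1
  have hpos1 : 0 ≤ (1 + η₁) ^ m + Kc * ε' := add_nonneg (le_trans zero_le_one hpow1') (mul_nonneg hKc0 hε'0)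
  have hρ0 : 0 ≤ R ^ (-(4 * (m : ℝ))) := Real.rpow_nonneg hR0.le _
  have h1 : M ^ m * Φ * ((1 + η₁) ^ m + Kc * ε') ≤ M ^ m * Ψ * ((1 + η₁) ^ m + Kc * ε') :=
    mul_le_mul_of_nonneg_right (mul_le_mul_of_nonneg_left hΦle hMm) hpos1
  have h2 : R ^ (-(4 * (m : ℝ))) ≤ R ^ (-(4 * (m : ℝ))) * (M ^ m * Ψ) :=
    le_mul_of_one_le_right hρ0 (one_le_mul_of_one_le_of_one_le hMm1 hΨ1)
  calc (𝔼 x ∈ Ico a (a + ℓ), ∏ i, truncatedDivisorSum R (W * (x + h i) + 1) ^ 2)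
      ≤ M ^ m * Φ * ((1 + η₁) ^ m + Kc * ε') + R ^ (-(4 * (m : ℝ))) := hE.trans (add_le_add hS le_rfl)
    _ ≤ M ^ m * Ψ * ((1 + η₁) ^ m + Kc * ε') + R ^ (-(4 * (m : ℝ))) * (M ^ m * Ψ) := add_le_add h1 h2
    _ = ((1 + η₁) ^ m + Kc * ε' + R ^ (-(4 * (m : ℝ)))) * M ^ m * Ψ := by ring
    _ = ((1 + 3 * Kd * 4 ^ w / lR + 8 * Real.exp 5 * Real.log w / w) ^ m + Kc * ε' + R ^ (-(4 * (m : ℝ)))) *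
          M ^ m * Ψ := by rw [hη₁, ← add_assoc]

/-! ### The limits -/

/-- `R = N^{k⁻¹ 2^{-k-4}} → ∞`. [cite: GreenTaoAnnals2008, Definition 9.3] -/
theorem tendsto_gyLevel (k : ℕ) (hk : 1 ≤ k) : Tendsto (fun N : ℕ => gyLevel k N) atTop atTop := by
  unfold gyLevel
  have hc : 0 < (k : ℝ)⁻¹ * 2⁻¹ ^ (k + 4) := by
    have : (0 : ℝ) < k := by exact_mod_cast hk
    positivity
  exact (tendsto_rpow_atTop hc).comp tendsto_natCast_atTop_atTop

/-- `log y / y → 0` along a sequence tending to infinity. [folklore] -/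
theorem tendsto_log_div_self_comp {f : ℕ → ℝ} (hf : Tendsto f atTop atTop) :
    Tendsto (fun N => Real.log (f N) / f N) atTop (𝓝 0) := by
  have h := Real.tendsto_pow_log_div_mul_add_atTop 1 0 1 one_ne_zero
  have h' : Tendsto (fun x : ℝ => Real.log x / x) atTop (𝓝 0) := by
    refine h.congr' ?_
    filter_upwards with x
    simp
  exact h'.comp hf

/-- `4^{⌊(log L)/2⌋} / L → 0` as `L → ∞` (`4^{(log L)/2} = L^{log 2}`, `log 2 < 1`). [folklore] -/
theorem tendsto_four_pow_floor_div {L : ℕ → ℝ} (hL : Tendsto L atTop atTop) :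
    Tendsto (fun N => (4 : ℝ) ^ ⌊Real.log (L N) / 2⌋₊ / L N) atTop (𝓝 0) := by
  have hlog2 : Real.log 2 < 1 := by
    have := Real.log_two_lt_d9; norm_num at this; linarith
  have hpos : 0 < 1 - Real.log 2 := by linarith
  have hlim : Tendsto (fun N => (L N) ^ (-(1 - Real.log 2))) atTop (𝓝 0) :=
    (tendsto_rpow_neg_atTop hpos).comp hL
  refine tendsto_of_tendsto_of_tendsto_of_le_of_le' tendsto_const_nhds hlim ?_ ?_
  · filter_upwards [hL.eventually_ge_atTop 1] with N hN
    positivity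
  · filter_upwards [hL.eventually_ge_atTop 1] with N hN
    have hL0 : 0 < L N := by linarith
    have hlogL : 0 ≤ Real.log (L N) := Real.log_nonneg hN
    -- `4^{⌊log L/2⌋} ≤ 4^{log L/2} = L^{log 2}`
    have h1 : (4 : ℝ) ^ ⌊Real.log (L N) / 2⌋₊ ≤ (L N) ^ Real.log 2 := by
      have h2 : ((4 : ℝ) ^ ⌊Real.log (L N) / 2⌋₊ : ℝ) = (4 : ℝ) ^ ((⌊Real.log (L N) / 2⌋₊ : ℕ) : ℝ) :=
        (Real.rpow_natCast _ _).symm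
      rw [h2]
      have h3 : ((⌊Real.log (L N) / 2⌋₊ : ℕ) : ℝ) ≤ Real.log (L N) / 2 := Nat.floor_le (by positivity)
      calc (4 : ℝ) ^ ((⌊Real.log (L N) / 2⌋₊ : ℕ) : ℝ) ≤ (4 : ℝ) ^ (Real.log (L N) / 2) :=
            Real.rpow_le_rpow_of_exponent_le (by norm_num) h3
        _ = (L N) ^ Real.log 2 := by
            rw [Real.rpow_def_of_pos (by norm_num : (0 : ℝ) < 4), Real.rpow_def_of_pos hL0,
              show (4 : ℝ) = 2 ^ 2 by norm_num, Real.log_pow]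
            congr 1
            push_cast
            ring
    calc (4 : ℝ) ^ ⌊Real.log (L N) / 2⌋₊ / L N ≤ (L N) ^ Real.log 2 / L N := div_le_div_of_nonneg_right h1 hL0.le
      _ = (L N) ^ (-(1 - Real.log 2)) := by
          rw [Real.rpow_neg hL0.le, Real.rpow_sub hL0, Real.rpow_one, inv_div]

/-! ### The discharge -/

/-- **Green–Tao 2008, Proposition 9.6 (Goldston–Yıldırım correlation estimate), proved.**
With `G(N) = ⌊log log R / 2⌋` and `C = (2B²)^m · 2 · 16^m`, the quantitative estimate
`expect_prod_sq_le` gives the `(1 + o(1))` form for every `w(N) → ∞` with `w ≤ G`.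
[cite: GreenTaoAnnals2008, Proposition 9.6] -/
theorem goldstonYildirimCorrelations_proof : GoldstonYildirimCorrelations := by
  intro k m hk hm
  obtain ⟨Kd, hKd0, hdiag⟩ := exists_diagSum_bound
  obtain ⟨B, hB1, hB⟩ := SharpGY.exists_moebLog_bound
  obtain ⟨C_G, hCG0, hG⟩ := exists_abs_invTotSum_sub_le
  set Kc : ℝ := (2 * B ^ 2) ^ m with hKc
  set R : ℕ → ℝ := fun N => gyLevel k N with hRdef
  set LR : ℕ → ℝ := fun N => Real.log (R N) with hLR
  set G : ℕ → ℕ := fun N => ⌊Real.log (LR N) / 2⌋₊ with hGdef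
  have hRt : Tendsto R atTop atTop := tendsto_gyLevel k (by omega)
  have hLRt : Tendsto LR atTop atTop := Real.tendsto_log_atTop.comp hRt
  have hLLRt : Tendsto (fun N => Real.log (LR N)) atTop atTop := Real.tendsto_log_atTop.comp hLRt
  have hGt : Tendsto G atTop atTop :=
    tendsto_nat_floor_atTop.comp (hLLRt.atTop_div_const (by norm_num : (0 : ℝ) < 2))
  refine ⟨Kc * (2 * 16 ^ m), by positivity, G, hGt, ?_⟩
  intro w hw hwG ε hε
  have hwR : Tendsto (fun N => (w N : ℝ)) atTop atTop := tendsto_natCast_atTop_atTop.comp hw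
  -- the pieces of the error tend to zero
  have hf₁ : Tendsto (fun N => (4 : ℝ) ^ G N / LR N) atTop (𝓝 0) := tendsto_four_pow_floor_div hLRt
  have hf₂ : Tendsto (fun N => Real.log (w N) / w N) atTop (𝓝 0) := tendsto_log_div_self_comp hwR
  have hf₃ : Tendsto (fun N => Real.exp (16 ^ m / w N) - 1) atTop (𝓝 0) := by
    have h1 : Tendsto (fun N => (16 : ℝ) ^ m / w N) atTop (𝓝 0) := tendsto_const_nhds.div_atTop hwR
    have h2 := (Real.continuous_exp.tendsto 0).comp h1
    rw [Real.exp_zero] at h2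
    have := h2.sub_const 1
    simpa using this
  have hf₄ : Tendsto (fun N => (R N) ^ (-(4 * (m : ℝ)))) atTop (𝓝 0) := by
    have hpos : 0 < 4 * (m : ℝ) := by have : (1 : ℝ) ≤ m := by exact_mod_cast hm
                                      linarith
    exact (tendsto_rpow_neg_atTop hpos).comp hRt
  have hf₅ : Tendsto (fun N => Real.log (LR N) / LR N) atTop (𝓝 0) := tendsto_log_div_self_comp hLRt
  -- the upper bound for `T(N)` tends to `1`
  have hTup : Tendsto (fun N => (1 + 3 * Kd * ((4 : ℝ) ^ G N / LR N) + 8 * Real.exp 5 * (Real.log (w N) / w N)) ^ m +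
      Kc * (Real.exp (16 ^ m / w N) - 1) + (R N) ^ (-(4 * (m : ℝ)))) atTop (𝓝 1) := by
    have h1 : Tendsto (fun N => 1 + 3 * Kd * ((4 : ℝ) ^ G N / LR N) + 8 * Real.exp 5 * (Real.log (w N) / w N))
        atTop (𝓝 (1 + 3 * Kd * 0 + 8 * Real.exp 5 * 0)) :=
      (tendsto_const_nhds.add (hf₁.const_mul _)).add (hf₂.const_mul _)
    have h2 := ((h1.pow m).add (hf₃.const_mul Kc)).add hf₄
    simp only [mul_zero, add_zero, one_pow] at h2
    exact h2
  have hev₁ : ∀ᶠ N in atTop, (1 + 3 * Kd * ((4 : ℝ) ^ G N / LR N) + 8 * Real.exp 5 * (Real.log (w N) / w N)) ^ m +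
      Kc * (Real.exp (16 ^ m / w N) - 1) + (R N) ^ (-(4 * (m : ℝ))) ≤ 1 + ε :=
    (hTup.eventually (eventually_le_nhds (by linarith))).mono fun N h => h
  have hev₂ : ∀ᶠ N in atTop, 2 ≤ w N := hw.eventually_ge_atTop 2
  have hev₃ : ∀ᶠ N in atTop, Real.exp 1 ≤ R N := hRt.eventually_ge_atTop _
  have hev₄ : ∀ᶠ N in atTop, C_G * (7 + G N) ≤ LR N := by
    -- `C_G (7 + G N)/LR N ≤ C_G (7/LR + (log LR)/(2 LR)) → 0`
    have h1 : Tendsto (fun N => C_G * (7 / LR N + Real.log (LR N) / LR N / 2)) atTop (𝓝 (C_G * (0 + 0 / 2))) :=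
      ((tendsto_const_nhds.div_atTop hLRt).add (hf₅.div_const 2)).const_mul C_G
    simp only [zero_div, add_zero, mul_zero] at h1
    filter_upwards [h1.eventually (eventually_le_nhds zero_lt_one), hLRt.eventually_ge_atTop 1] with N hN hL1
    have hL0 : 0 < LR N := by linarith
    have hGle : (G N : ℝ) ≤ Real.log (LR N) / 2 := Nat.floor_le (by
      have : 0 ≤ Real.log (LR N) := Real.log_nonneg hL1
      positivity)
    have h2 : C_G * (7 + G N) / LR N ≤ 1 := by
      calc C_G * (7 + G N) / LR N = C_G * (7 / LR N + (G N : ℝ) / LR N) := by field_simp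
        _ ≤ C_G * (7 / LR N + Real.log (LR N) / LR N / 2) := by
            refine mul_le_mul_of_nonneg_left (add_le_add le_rfl ?_) hCG0
            calc (G N : ℝ) / LR N ≤ (Real.log (LR N) / 2) / LR N := div_le_div_of_nonneg_right hGle hL0.le
              _ = Real.log (LR N) / LR N / 2 := by ring
        _ ≤ 1 := hN
    rwa [div_le_one hL0] at h2
  filter_upwards [hev₁, hev₂, hev₃, hev₄] with N hT hw2 hR3 hη _hprime h hinj _hh a ℓ hℓ
  have hwG' : w N ≤ G N := hwG N
  have hη₂ : C_G * (7 + w N) ≤ Real.log (gyLevel k N) := by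
    have : (w N : ℝ) ≤ G N := by exact_mod_cast hwG'
    calc C_G * (7 + w N) ≤ C_G * (7 + G N) := by nlinarith
      _ ≤ LR N := hη
  have hmain := expect_prod_sq_le hB1 hB hKd0 hdiag hCG0 hG hw2 hR3 hη₂ hinj a ℓ hℓ
  refine hmain.trans ?_
  have hM0 : 0 ≤ ((primorial (w N) : ℝ) * Real.log (gyLevel k N) / Nat.totient (primorial (w N))) ^ m := by
    apply pow_nonneg
    have : 0 ≤ Real.log (gyLevel k N) := Real.log_nonneg (le_trans (by have := Real.add_one_le_exp (1:ℝ); linarith) hR3)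
    positivity
  have hΨ0 : 0 ≤ ∏ p ∈ (∏ i, ∏ j ∈ univ.filter (fun j => i < j), |h i - h j|).natAbs.primeFactors,
      (1 + Kc * (2 * 16 ^ m) * (p : ℝ) ^ (-(1 / 2 : ℝ))) := Finset.prod_nonneg fun p _ => by positivity
  refine mul_le_mul_of_nonneg_right (mul_le_mul_of_nonneg_right ?_ hM0) hΨ0
  -- `T(N) ≤ Tup(N) ≤ 1 + ε`
  refine le_trans ?_ hT
  have hLR0 : 0 < Real.log (R N) := by
    have h1 : 1 ≤ Real.log (R N) := by
      rw [← Real.log_exp 1]; exact Real.log_le_log (Real.exp_pos 1) hR3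
    linarith
  have h4 : (4 : ℝ) ^ w N ≤ 4 ^ G N := pow_le_pow_right₀ (by norm_num) hwG'
  have hw0 : (0 : ℝ) < w N := by exact_mod_cast (show 0 < w N by omega)
  have hlogw : 0 ≤ Real.log (w N) := Real.log_nonneg (by exact_mod_cast (show 1 ≤ w N by omega))
  have e0 : LR N = Real.log (R N) := rfl
  have hbase : 1 + 3 * Kd * 4 ^ w N / Real.log (R N) + 8 * Real.exp 5 * Real.log (w N) / w N ≤
      1 + 3 * Kd * ((4 : ℝ) ^ G N / LR N) + 8 * Real.exp 5 * (Real.log (w N) / w N) := by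
    rw [e0]
    have : 3 * Kd * 4 ^ w N / Real.log (R N) ≤ 3 * Kd * ((4 : ℝ) ^ G N / Real.log (R N)) := by
      rw [mul_div_assoc]
      exact mul_le_mul_of_nonneg_left (div_le_div_of_nonneg_right h4 hLR0.le) (by positivity)
    have e : 8 * Real.exp 5 * Real.log (w N) / w N = 8 * Real.exp 5 * (Real.log (w N) / w N) := by ring
    linarith
  have hbase0 : 0 ≤ 1 + 3 * Kd * 4 ^ w N / Real.log (R N) + 8 * Real.exp 5 * Real.log (w N) / w N := by
    have := hLR0.le
    positivity
  have hp := pow_le_pow_left₀ hbase0 hbase m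
  rw [← hKc]
  linarith [hp]

end GYCorr

/-- **Green–Tao 2008, Proposition 9.6** — the named fact `GoldstonYildirimCorrelations` holds.
[cite: GreenTaoAnnals2008, Proposition 9.6] -/
theorem GoldstonYildirimCorrelations_holds : GoldstonYildirimCorrelations :=
  GYCorr.goldstonYildirimCorrelations_proof

end Literature.NumberTheory.Sieve.GreenTao2008
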